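import Literature.NumberTheory.LFunctions.RosserSchoenfeldMertensChainCheck
import Literature.NumberTheory.LFunctions.ThetaChainSound
import Literature.NumberTheory.LFunctions.RosserSchoenfeldMertensFirstConstant
import HarnessLib

/-!
# Rosser–Schoenfeld 1962, (3.21) on a finite range by kernel computation: soundness of the checker

Literature/NumberTheory/LFunctions. The semantic soundness of the (3.21)-chain checker
`RosserSchoenfeldMertensChainCheck.lean` over the complete prime table `ChainTable.table`
(`ChainTableFacts.tableOK`), for J. B. Rosser, L. Schoenfeld, Illinois J. Math. 6 (1962), Thm. 6,
(3.21): `log x + E − 1/(2 log x) < S(x) = Σ_{p ≤ x} (log p)/p`. If a chunk of the run succeeds,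
`runD fuel s = some s'`, the **invariant** `Inv s` is transported to `s'` (`runD_sound`); the
initial state satisfies it (`initS_inv`); and the invariant at a state with prime `P` contains
(3.21) for every real `2 ≤ x < P` (`Inv.claim`). Everything here is proved (one
`structure … : Prop`, the invariant).

## The argument (as in `ThetaChainSound.lean`)

* `Inv s` (state at the prime `p = s.p`): `p` is a table entry and prime; `Llo ≤ 2⁸⁰ log p ≤ Lhi`;
  `Slo ≤ 2⁸⁰ S(p)`; `Plo ≤ 2⁸⁰ P(p)`, `P(p) = Σ_{q ≤ p} (log q)/(q(q−1))`; and (3.21) for all real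
  `2 ≤ x < p`.
* One step `p → p'` (`step_inv`): `p'` is the table successor of `p`, odd, prime by
  `ThetaChain.primeChk_sound`; by completeness of the table there is no prime in `(p, p')`, so `S`
  is constant `= S(p)` on `[p, p')` and `S(p') = S(p) + (log p')/p'`,
  `P(p') = P(p) + (log p')/(p'(p'−1))` (`sum_primesLE_succ_prime`); `ThetaChain.logNext_sound`
  gives the new enclosure. The comparison
  `chk321` gives `log p' + E − 1/(2 log p') ≤ S(p)` (`chk321_sound`, with
  `E ≤ −γ − P(p) ≤ −(GAMMALO + Plo)/2⁸⁰`, `neg_rosserSchoenfeldE_ge`), and since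
  `x ↦ log x + E − 1/(2 log x)` is strictly increasing on `(1, ∞)` (`rhs_strictMono`), (3.21) holds
  on `[p, p')`.
* `run_sound`/`runD_sound` iterate along `ChainCheck.after p table`; `initS_inv`:
  `S(2) = P(2) = (log 2)/2`.

## References
* J. B. Rosser, L. Schoenfeld, Illinois J. Math. 6 (1962), 64–94, Thm. 6 (3.21); pp. 76, 87 (the
  tabulated ranges `x ≤ 16 000`, `x ≤ 10⁸` of its proof). [RosserSchoenfeld1962]
-/

noncomputable section

namespace Literature.NumberTheory.LFunctions.MertensChain

open ChainCheck ChainTable ThetaChain Real Finset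

/-! ### Prime sums along the integers -/

/-- `Σ_{q ≤ n+1, q prime} g(q) = Σ_{q ≤ n, q prime} g(q) + g(n+1)` if `n+1` is prime, unchanged
otherwise. [folklore] -/
theorem sum_primesLE_succ (g : ℕ → ℝ) (n : ℕ) :
    ∑ q ∈ Nat.primesLE (n + 1), g q =
      (∑ q ∈ Nat.primesLE n, g q) + if (n + 1).Prime then g (n + 1) else 0 := by
  rw [Nat.primesLE_eq_filter_Ioc_zero, Nat.primesLE_eq_filter_Ioc_zero, Finset.sum_filter,
    Finset.sum_filter, Finset.sum_Ioc_succ_top (Nat.zero_le n)]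

/-- If there is no prime in `(p, n]` then `Σ_{q ≤ n} g = Σ_{q ≤ p} g` (sums over primes).
[folklore] -/
theorem sum_primesLE_eq_of_noPrime (g : ℕ → ℝ) {p : ℕ} :
    ∀ {n : ℕ}, p ≤ n → (∀ q : ℕ, p < q → q ≤ n → ¬ q.Prime) →
      ∑ q ∈ Nat.primesLE n, g q = ∑ q ∈ Nat.primesLE p, g q
  | 0, h, _ => by
      have : p = 0 := by omega
      subst this; rfl
  | n + 1, h, hq => by
      rcases Nat.eq_or_lt_of_le h with rfl | hlt
      · rfl
      · rw [sum_primesLE_succ, if_neg (hq (n + 1) (by omega) le_rfl), add_zero]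
        exact sum_primesLE_eq_of_noPrime g (by omega) fun q h1 h2 => hq q h1 (by omega)

/-- If `p'` is prime and there is no prime in `(p, p')` then `Σ_{q ≤ p'} g = Σ_{q ≤ p} g + g(p')`.
[folklore] -/
theorem sum_primesLE_succ_prime (g : ℕ → ℝ) {p p' : ℕ} (hp' : p'.Prime) (hlt : p < p')
    (hq : ∀ q : ℕ, p < q → q < p' → ¬ q.Prime) :
    ∑ q ∈ Nat.primesLE p', g q = (∑ q ∈ Nat.primesLE p, g q) + g p' := by
  obtain ⟨m, rfl⟩ : ∃ m, p' = m + 1 := ⟨p' - 1, by have := hp'.one_lt; omega⟩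
  rw [sum_primesLE_succ, if_pos hp',
    sum_primesLE_eq_of_noPrime g (by omega) fun q h1 h2 => hq q h1 (by omega)]

/-- `S` is constant on `[p, p')` when there is no prime in `(p, p')`: for real `p ≤ x < p'`,
`S(x) = S(p)` (`S = Mertens.primeLogDivSum`). [folklore] -/
theorem primeLogDivSum_real_eq {p p' : ℕ} (hq : ∀ q : ℕ, p < q → q < p' → ¬ q.Prime) {x : ℝ}
    (hpx : (p : ℝ) ≤ x) (hxp : x < p') :
    Mertens.primeLogDivSum x = Mertens.primeLogDivSum p := by
  have hx0 : 0 ≤ x := le_trans (Nat.cast_nonneg p) hpx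
  unfold Mertens.primeLogDivSum
  rw [Nat.floor_natCast]
  have h1 : p ≤ ⌊x⌋₊ := Nat.le_floor hpx
  have h2 : ⌊x⌋₊ < p' := (Nat.floor_lt hx0).2 hxp
  exact sum_primesLE_eq_of_noPrime _ h1 fun q hq1 hq2 => hq q hq1 (by omega)

/-- `S(n) = Σ_{q ≤ n} (log q)/q` at a natural number. [folklore] -/
theorem primeLogDivSum_natCast (n : ℕ) :
    Mertens.primeLogDivSum n = ∑ q ∈ Nat.primesLE n, Real.log q / q := by
  unfold Mertens.primeLogDivSum
  rw [Nat.floor_natCast]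

/-! ### The right-hand side `log x + E − 1/(2 log x)` increases -/

/-- `x ↦ log x + E − 1/(2 log x)` is strictly increasing on `(1, ∞)`. [folklore] -/
theorem rhs_strictMono (E : ℝ) {x y : ℝ} (hx : 1 < x) (hxy : x < y) :
    Real.log x + E - 1 / (2 * Real.log x) < Real.log y + E - 1 / (2 * Real.log y) := by
  have hlx : 0 < Real.log x := Real.log_pos hx
  have hlxy : Real.log x < Real.log y := Real.log_lt_log (by linarith) hxy
  have h : 1 / (2 * Real.log y) < 1 / (2 * Real.log x) :=
    one_div_lt_one_div_of_lt (by positivity) (by linarith)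
  linarith

/-! ### The bound for `E`: `γ + Σ_{q ≤ n} (log q)/(q(q−1)) ≤ −E` -/

/-- Every partial sum of the series of (2.8) is below its sum `−γ − E`
(`hasSum_primes_log_div_mul_pred`). [cite: RosserSchoenfeld1962, (2.8)] -/
theorem neg_rosserSchoenfeldE_ge (n : ℕ) :
    Real.eulerMascheroniConstant + ∑ q ∈ Nat.primesLE n, Real.log q / ((q : ℝ) * ((q : ℝ) - 1)) ≤
      -rosserSchoenfeldE := by
  have hsum := hasSum_primes_log_div_mul_pred
  set g : Nat.Primes → ℝ := fun p ↦ Real.log (p : ℝ) / ((p : ℝ) * ((p : ℝ) - 1)) with hg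
  have hg0 : ∀ p, 0 ≤ g p := fun p ↦ by
    have hp2 : (2 : ℝ) ≤ p := by exact_mod_cast p.2.two_le
    exact div_nonneg (Real.log_nonneg (by linarith)) (by nlinarith)
  -- the primes `≤ n` as a finite set of `Nat.Primes`
  let emb : {q // q ∈ Nat.primesLE n} ↪ Nat.Primes :=
    ⟨fun q ↦ ⟨q.1, Nat.prime_of_mem_primesLE q.2⟩, fun a b h ↦
      Subtype.ext (by simpa using congrArg Subtype.val h)⟩
  have hle : ∑ p ∈ (Nat.primesLE n).attach.map emb, g p ≤
      -Real.eulerMascheroniConstant - rosserSchoenfeldE := by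
    rw [← hsum.tsum_eq]
    exact hsum.summable.sum_le_tsum _ fun p _ ↦ hg0 p
  have heq : ∑ p ∈ (Nat.primesLE n).attach.map emb, g p =
      ∑ q ∈ Nat.primesLE n, Real.log q / ((q : ℝ) * ((q : ℝ) - 1)) := by
    rw [Finset.sum_map, ← Finset.sum_attach (Nat.primesLE n)]
    rfl
  linarith

/-! ### The invariant -/

/-- **The invariant** of a state of the (3.21)-chain (relative to the table `ChainTable.table`).
[cite: RosserSchoenfeld1962, Thm. 6 (3.21)] -/
structure Inv (s : MS) : Prop where
  /-- the prime reached is a table entry -/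
  mem : s.p ∈ table
  /-- and is prime -/
  prime : s.p.Prime
  /-- `Llo ≤ 2⁸⁰ log p` -/
  Llo_le : (s.Llo : ℝ) ≤ 2 ^ 80 * Real.log s.p
  /-- `2⁸⁰ log p ≤ Lhi` -/
  le_Lhi : 2 ^ 80 * Real.log s.p ≤ s.Lhi
  /-- `Slo ≤ 2⁸⁰ S(p)` -/
  Slo_le : (s.Slo : ℝ) ≤ 2 ^ 80 * Mertens.primeLogDivSum s.p
  /-- `Plo ≤ 2⁸⁰ Σ_{q ≤ p} (log q)/(q(q−1))` -/
  Plo_le : (s.Plo : ℝ) ≤ 2 ^ 80 * ∑ q ∈ Nat.primesLE s.p, Real.log q / ((q : ℝ) * ((q : ℝ) - 1))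
  /-- (3.21) below `p` -/
  claim : ∀ x : ℝ, 2 ≤ x → x < s.p →
    Real.log x + rosserSchoenfeldE - 1 / (2 * Real.log x) < Mertens.primeLogDivSum x

/-! ### One step -/

/-- **Soundness of one step.** If `Inv s` holds, `p'` is the table successor of `s.p`, and
`step s p' = some s'`, then `Inv s'` and `s'.p = p'`. [cite: RosserSchoenfeld1962, Thm. 6 (3.21)] -/
theorem step_inv {s s' : MS} (hI : Inv s) {p' : ℕ} {rest : List ℕ}
    (hafter : after s.p table = p' :: rest) (h : step s p' = some s') : Inv s' ∧ s'.p = p' := by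
  have hT := tableOK
  obtain ⟨p, Llo, Lhi, Slo, Plo⟩ := s
  simp only at hafter hI
  obtain ⟨hmem, hprime, hLlo, hLhi, hSlo, hPlo, hclaim⟩ := hI
  simp only at hmem hprime hLlo hLhi hSlo hPlo hclaim
  -- the successor `p'`
  obtain ⟨hp'T, hpp', hmin⟩ := head_after hT.sorted hafter
  have hp'le : p' ≤ 4599989 := hT.bounded p' hp'T
  have hnoprime : ∀ q : ℕ, p < q → q < p' → ¬ q.Prime := fun q h1 h2 hq =>
    absurd (hmin q (hT.complete q hq (by omega)) h1) (not_le.2 h2)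
  have hp2 : 2 ≤ p := hprime.two_le
  have hp0 : 0 < p := hprime.pos
  -- unfold the step
  simp only [step, Nat.mul_eq, Nat.sub_eq, Nat.add_eq] at h
  obtain ⟨hg1, h⟩ := bif_not_none h
  simp only [Bool.and_eq_true] at hg1
  obtain ⟨⟨-, hodd⟩, hchk⟩ := hg1
  have hodd' : Odd p' := Nat.odd_iff.2 (Nat.eq_of_beq_eq_true hodd)
  have hp'prime : p'.Prime := primeChk_sound hchk hodd' (by omega)
  rcases hln : logNext p Llo Lhi p' with _ | ⟨Llo', Lhi'⟩
  · rw [hln] at h; simp at h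
  · rw [hln] at h
    simp only at h
    obtain ⟨hg2, h⟩ := bif_not_none h
    simp only [Option.some.injEq] at h
    subst h
    -- the new enclosure of `log p'`
    obtain ⟨hLlo', hLhi'⟩ := logNext_sound hln hp0 hpp'.le hLlo hLhi
    have hp'2 : (2 : ℝ) < p' := by
      have : 2 < p' := lt_of_le_of_lt hp2 hpp'
      exact_mod_cast this
    have hp'0 : (0 : ℝ) < p' := by linarith
    have hlogp' : 0 < Real.log p' := Real.log_pos (by linarith)
    -- the sums at `p'`
    have hS' : Mertens.primeLogDivSum p' = Mertens.primeLogDivSum p + Real.log p' / p' := by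
      rw [primeLogDivSum_natCast, primeLogDivSum_natCast]
      exact sum_primesLE_succ_prime (fun q : ℕ ↦ Real.log q / q) hp'prime hpp' hnoprime
    have hP' : ∑ q ∈ Nat.primesLE p', Real.log q / ((q : ℝ) * ((q : ℝ) - 1)) =
        (∑ q ∈ Nat.primesLE p, Real.log q / ((q : ℝ) * ((q : ℝ) - 1))) +
          Real.log p' / ((p' : ℝ) * ((p' : ℝ) - 1)) :=
      sum_primesLE_succ_prime (fun q : ℕ ↦ Real.log q / ((q : ℝ) * ((q : ℝ) - 1))) hp'prime hpp'
        hnoprime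
    -- the comparison: `log p' + E − 1/(2 log p') ≤ S(p)`
    have hE : ((GAMMALO + Plo : ℕ) : ℝ) ≤ 2 ^ 80 * (-rosserSchoenfeldE) := by
      have h1 := GAMMALO_le
      have h2 := neg_rosserSchoenfeldE_ge p
      push_cast
      nlinarith
    have hcmp : Real.log p' + rosserSchoenfeldE - 1 / (2 * Real.log p') ≤
        Mertens.primeLogDivSum p :=
      chk321_sound hg2 hlogp' hLhi' hSlo hE
    refine ⟨⟨hp'T, hp'prime, hLlo', hLhi', ?_, ?_, ?_⟩, rfl⟩
    · -- `Slo' ≤ 2⁸⁰ S(p')`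
      simp only
      rw [hS']
      push_cast
      have h1 := natDiv_le_real Llo' p'
      have h2 : (Llo' : ℝ) / p' ≤ 2 ^ 80 * Real.log p' / p' :=
        div_le_div_of_nonneg_right hLlo' hp'0.le
      have h3 : 2 ^ 80 * Real.log p' / p' = 2 ^ 80 * (Real.log p' / p') := by ring
      linarith
    · -- `Plo' ≤ 2⁸⁰ P(p')`
      simp only
      rw [hP']
      push_cast
      have hden : (0 : ℝ) < (p' : ℝ) * ((p' : ℝ) - 1) := by nlinarith
      have hcast : (((p' * (p' - 1) : ℕ)) : ℝ) = (p' : ℝ) * ((p' : ℝ) - 1) := by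
        have : 1 ≤ p' := by omega
        push_cast [Nat.cast_sub this]
        ring
      have h1 := natDiv_le_real Llo' (p' * (p' - 1))
      rw [hcast] at h1
      have h2 : (Llo' : ℝ) / ((p' : ℝ) * ((p' : ℝ) - 1)) ≤
          2 ^ 80 * Real.log p' / ((p' : ℝ) * ((p' : ℝ) - 1)) :=
        div_le_div_of_nonneg_right hLlo' hden.le
      have h3 : 2 ^ 80 * Real.log p' / ((p' : ℝ) * ((p' : ℝ) - 1)) =
          2 ^ 80 * (Real.log p' / ((p' : ℝ) * ((p' : ℝ) - 1))) := by ring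
      linarith
    · -- (3.21) below `p'`
      intro x hx hxp'
      simp only at hxp'
      by_cases hxp : x < p
      · exact hclaim x hx hxp
      · push Not at hxp
        have hx1 : 1 < x := by linarith
        rw [primeLogDivSum_real_eq hnoprime hxp hxp']
        exact lt_of_lt_of_le (rhs_strictMono rosserSchoenfeldE hx1 hxp') hcmp

/-! ### The run -/

/-- **Soundness of a run** along the table cursor. [folklore] -/
theorem run_sound : ∀ (fuel : ℕ) {s s' : MS}, Inv s → run fuel s (after s.p table) = some s' →
    Inv s'
  | 0, s, s', hI, h => by
      simp only [run, Option.some.injEq] at h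
      exact h ▸ hI
  | fuel + 1, s, s', hI, h => by
      rcases hseg : after s.p table with _ | ⟨p', rest⟩
      · rw [hseg] at h
        simp only [run, Option.some.injEq] at h
        exact h ▸ hI
      · rw [hseg] at h
        simp only [run] at h
        rcases hst : step s p' with _ | s₁
        · rw [hst] at h; simp at h
        · rw [hst] at h
          simp only at h
          obtain ⟨hI₁, hp₁⟩ := step_inv hI hseg hst
          have hrest : rest = after s₁.p table := by
            rw [hp₁]; exact tail_after tableOK.sorted hseg
          rw [hrest] at h
          exact run_sound fuel hI₁ h

/-- **Soundness of a chunk**: `runD` preserves the invariant. [folklore] -/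
theorem runD_sound {fuel : ℕ} {s s' : MS} (hI : Inv s) (h : runD fuel s = some s') : Inv s' :=
  run_sound fuel hI h

/-! ### The initial state -/

/-- `S(2) = (log 2)/2`. [folklore] -/
theorem primeLogDivSum_two : Mertens.primeLogDivSum 2 = Real.log 2 / 2 := by
  have h := primeLogDivSum_natCast 2
  rw [Mertens.primesLE_two, Finset.sum_singleton] at h
  exact_mod_cast h

/-- `Σ_{q ≤ 2} (log q)/(q(q−1)) = (log 2)/2`. [folklore] -/
theorem sum_primesLE_two_log_div :
    ∑ q ∈ Nat.primesLE 2, Real.log q / ((q : ℝ) * ((q : ℝ) - 1)) = Real.log 2 / 2 := by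
  rw [Mertens.primesLE_two, Finset.sum_singleton]
  norm_num

/-- **The initial state satisfies the invariant.** [folklore] -/
theorem initS_inv : Inv initS := by
  have hlo := L2LON_le
  have h2 : ((Nat.div L2LON 2 : ℕ) : ℝ) ≤ 2 ^ 80 * (Real.log 2 / 2) := by
    have := natDiv_le_real L2LON 2
    push_cast at this
    linarith
  refine ⟨tableOK.two_mem, Nat.prime_two, ?_, ?_, ?_, ?_, ?_⟩
  · simpa [initS] using L2LON_le
  · simpa [initS] using le_L2HIN
  · simp only [initS]; push_cast; rw [primeLogDivSum_two]; exact h2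
  · simp only [initS]; rw [sum_primesLE_two_log_div]; exact h2
  · intro x hx hx2
    have hx2' : x < 2 := by exact_mod_cast hx2
    linarith

/-- **(3.21) from a reached state**: if the invariant holds at a state with prime `P`, then
`log x + E − 1/(2 log x) < Σ_{p ≤ x} (log p)/p` for every real `2 ≤ x < P`.
[cite: RosserSchoenfeld1962, Thm. 6 (3.21)] -/
theorem lt_sum_of_inv {s : MS} (hI : Inv s) {x : ℝ} (hx : 2 ≤ x) (hxP : x < s.p) :
    Real.log x + rosserSchoenfeldE - 1 / (2 * Real.log x) <
      ∑ p ∈ Nat.primesLE ⌊x⌋₊, Real.log p / p :=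
  hI.claim x hx hxP

end Literature.NumberTheory.LFunctions.MertensChain

end
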